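import Summits.NavierStokesRegularity.NavierStokesRegularity.Theses.PumpContinuation
import Summits.NavierStokesRegularity.NavierStokesRegularity.Theses.DssFarFieldSlaving
import Summits.NavierStokesRegularity.NavierStokesRegularity.Theorems.PumpContinuationEulerProximatePumpClassicalToMild

/-!
# Route PumpContinuation · crux `EulerProximatePump` (stmt-NavierStokesRegularity-18302) · line `SketchIdeator2`
# Stub `stub_transfer`: the Door is downstream of the DSS-profile chain of route `DssFarFieldSlaving`

The TRANSFER of the crux (card `zoom-sandwich`, positive line `door_of_dssChain`; tier (i) of card `conley-door`):

* `pumpContinuation_eulerProximatePump_of_nsTypeI` — **Door ⇐ NSTypeI** (the standing disprover's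
  `door_of_nsTypeI`, refuter-rattack 2026-08-17, landed here as an importable lemma): a Schwartz-data
  `H¹⁰_df`-mild Type-I blow-up of the TRUE Navier–Stokes form `B` with no mild extension gives the Door, with
  the Euler datum as `𝒜` — `B̃_euler = B` (`AveragingDatum.euler_form`), so the segment form
  `(1-θ)B̃_𝒜 + θB` is `B` for every `θ` — and `θ := max (1 - δ/2) 0`.
* `stub_transfer` (registered) — `BlowupTypeIDssProfile → DssTruncationBridgeTypeI → EulerProximatePump`:
  the Type-I DSS profile (item stmt-NavierStokesRegularity-0155) is truncated to a classical maximal Type-I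
  blow-up from a rapidly decaying datum (item stmt-NavierStokesRegularity-14478), which the landed bookkeeping
  `stub_classicalTypeIToMild` turns into the hypothesis of the first lemma.

So the composition `EulerProximatePump_of` of the line is kernel-checked modulo exactly the two items 0155 and
14478 of route `DssFarFieldSlaving` (conditional result; nothing else is assumed).

## References

* T. Tao, J. Amer. Math. Soc. 29 (2016), arXiv:1402.0290v3, §1.1 (1.5), (1.13), (1.15). [Tao2016AveragedNS]
-/

noncomputable section

open MeasureTheory Set Filter
open scoped ENNReal

-- the nested summit namespace `…NavierStokesRegularity.NavierStokesRegularity…` is the tree's layout (D-0017)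
set_option linter.dupNamespace false

namespace Summit.NavierStokesRegularity.NavierStokesRegularity.Theorems

open Literature.Analysis.FluidPDE Literature.Analysis.FluidPDE.Tao2016

/-- **Door ⇐ NSTypeI** (the standing Disproof's `door_of_nsTypeI`): a Schwartz-data `H¹⁰_df`-mild Type-I
blow-up of the true Navier–Stokes form `B` (Tao (1.5), `ν = 1`) with ceiling `M` and no mild extension gives
the Door `EulerProximatePump`, with the Euler datum as `𝒜` (`euler_form : B̃_euler = B`, so the segment form is
`B` for every `θ`) and `θ := max (1 - δ/2) 0 ∈ (1-δ, 1) ∩ [0,1)`. [cite: Tao2016AveragedNS, §1.1 (1.5) and (1.13)] -/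
theorem pumpContinuation_eulerProximatePump_of_nsTypeI
    (h : ∃ M : ℝ, ∃ u₀ : SchwartzMap (EuclideanSpace ℝ (Fin 3)) (EuclideanSpace ℝ (Fin 3)),
        VectorCalculus.IsDivFree ⇑u₀ ∧ ∃ S : ℝ, 0 < S ∧ ∃ U : ℝ → L2C,
          IsMildSolutionFor eulerForm (schwartzL2 u₀) (Ico 0 S) U ∧
          (∀ t ∈ Ico 0 S, eLpNorm (U t) ⊤ volume ≤ ENNReal.ofReal (M / Real.sqrt (S - t))) ∧
          ¬ ∃ S' : ℝ, S < S' ∧ ∃ v : ℝ → L2C,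
              IsMildSolutionFor eulerForm (schwartzL2 u₀) (Ico 0 S') v ∧ ∀ t ∈ Ico 0 S, v t = U t) :
    Theses.PumpContinuation.EulerProximatePump := by
  obtain ⟨M, hM⟩ := h
  refine ⟨AveragingDatum.euler, AveragingDatum.euler_isSymmetric,
    AveragingDatum.euler_hasCancellation, M, fun δ hδ => ?_⟩
  refine ⟨max (1 - δ / 2) 0, lt_of_lt_of_le (by linarith) (le_max_left _ _),
    max_lt (by linarith) one_pos, le_max_right _ _, ?_⟩
  have hform : (fun a b c => (((1 - max (1 - δ / 2) 0 : ℝ) : ℝ) : ℂ) * AveragingDatum.euler.form a b c +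
      (((max (1 - δ / 2) 0 : ℝ) : ℝ) : ℂ) * eulerForm a b c) = eulerForm := by
    funext a b c
    rw [AveragingDatum.euler_form]
    push_cast
    ring
  rw [hform]
  exact hM

namespace PumpContinuationEulerProximatePump

/-- **Stub `stub_transfer` (registered): the Door is downstream of route `DssFarFieldSlaving`.** A Type-I DSS
profile (`BlowupTypeIDssProfile`, stmt-0155) and the Type-I truncation bridge (`DssTruncationBridgeTypeI`,
stmt-14478) give a classical maximal Type-I blow-up from a rapidly decaying datum; `stub_classicalTypeIToMild`
makes it a Schwartz-data `H¹⁰_df`-mild Type-I blow-up of `B` with no mild extension; the Euler-datum collapse of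
the segment (`pumpContinuation_eulerProximatePump_of_nsTypeI`) gives the Door. [folklore] -/
theorem stub_transfer :
    Theses.DssFarFieldSlaving.BlowupTypeIDssProfile → Theses.DssFarFieldSlaving.DssTruncationBridgeTypeI →
      Theses.PumpContinuation.EulerProximatePump := by
  intro hP hB
  obtain ⟨ν, hν, T, hT, u, p, hmax, hLH, hdec, hI⟩ := hB hP
  obtain ⟨M, hM⟩ := stub_classicalTypeIToMild ν hν T hT u p hmax hLH hdec hI
  exact pumpContinuation_eulerProximatePump_of_nsTypeI ⟨M, hM⟩

end PumpContinuationEulerProximatePump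

end Summit.NavierStokesRegularity.NavierStokesRegularity.Theorems

end
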